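import Summits.AnomalousDissipation.AnomalousDissipation.Theorems.NewtonRealisation.Negative.BorderedBoundShear
import Literature.Analysis.FunctionSpaces.TorusSpaceTime

/-!
# Negative lemmas for crux `NeutralTaylorWaves.NewtonRealisation` (stmt-AnomalousDissipation-16315):
# the transfer `C⁺` is not vacuous, and it needs the mean-zero force

Continuation of `BorderedBoundShear` (refuter cdisprove, 2026-08-17):

* `shear_exact`, `shear_data` — the axial shear state `u₀ = ν sin(2πx₃) e₀` is an EXACT drifted
  steady state (`p₀ = 0`, `c = 0`) of the smooth mean-zero force `f₀ = 4π²ν u₀`; it is smooth,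
  divergence free, mean zero, `|u₀| ≤ ν`, `|∂u₀| ≤ 2πν`, and genuinely three-dimensional,
  `‖∂₃u₀‖₂² = 2π²ν²`.
* `quantPersistence_hypotheses_inhabited` — hence for every `0 < ν ≤ 1` ALL inner hypotheses of the
  line's transfer `C⁺ = stub_quantPersistenceCore` hold at once (`C = 2π`, `M = 5ν⁻¹`, the bordered
  bound from `borderedBound_shear`): the transfer is NOT vacuous, and the crux's a-priori clause has a
  non-junk model at fixed viscosity (what is open in the target is loud + light + fixed `f` as `ν → 0`,
  not the clause).
* `integral_steadyLHS_eq_zero` — the full steady left-hand side `u·∇u − νΔu + ∇p − c∂₃u` of a smooth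
  divergence-free `u` has mean zero (the solvability obstruction; calculus fact (i) of the line).
* `quantPersistence_false_without_meanZero_f` — `C⁺` with the hypothesis `HasZeroMean f` DELETED is
  FALSE: at the shear state (`ν = 1`) the smooth divergence-free force `f = f₀ + P⁻²e₀` lies in the
  Kantorovich ball `‖f − f₀‖₂² = P⁻⁴` yet has mean `P⁻²e₀ ≠ 0`, so no exact state realises it.  The
  conserved-mean leaf (`HasZeroMean f`) is load-bearing in stub C.
-/

set_option linter.dupNamespace false

noncomputable section

namespace Summit.AnomalousDissipation.AnomalousDissipation.Theorems.NewtonRealisation.Negative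

open MeasureTheory
open scoped InnerProductSpace RealInnerProductSpace
open Literature.Analysis.FluidPDE Literature.Analysis.FluidPDE.Torus
open Literature.Analysis.FunctionSpaces Literature.Analysis.FunctionSpaces.Torus
open Summit.AnomalousDissipation.AnomalousDissipation.Theorems.EnsembleRigidity.GPStatisticalRigidity
  (gpForce_fderiv_stokesMode_sin gpForce_integral_norm_sq_stokesMode)
open Summit.AnomalousDissipation.AnomalousDissipation.Theorems (AcdcStrain.partialDeriv_stokesMode_sin)

section ExactState

/-- The gradient of the zero scalar vanishes. [folklore] -/
theorem gradient_zero_scalar'' (x : UnitAddTorus (Fin 3)) :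
    Torus.gradient (fun _ : UnitAddTorus (Fin 3) => (0 : ℝ)) x = 0 := by
  unfold Torus.gradient Torus.liftAt
  simp [_root_.gradient]

/-- **The shear state is an exact drifted steady state** (drift `c = 0`, pressure `0`) of the smooth
mean-zero force `f₀ = 4π²ν u₀`: `u₀·∇u₀ − νΔu₀ + ∇0 − 0·∂₃u₀ = 4π²ν u₀`. -/
theorem shear_exact (ν : ℝ) (x : UnitAddTorus (Fin 3)) :
    Torus.convect (⇑(stokesMode (Pi.single (2 : Fin 3) (1 : ℤ)) (EuclideanSpace.single (0 : Fin 3) ν) false))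
        (⇑(stokesMode (Pi.single (2 : Fin 3) (1 : ℤ)) (EuclideanSpace.single (0 : Fin 3) ν) false)) x -
      ν • Torus.laplacian (⇑(stokesMode (Pi.single (2 : Fin 3) (1 : ℤ)) (EuclideanSpace.single (0 : Fin 3) ν) false)) x +
      Torus.gradient (fun _ : UnitAddTorus (Fin 3) => (0 : ℝ)) x -
      (0 : ℝ) • Torus.partialDeriv (2 : Fin 3)
        (⇑(stokesMode (Pi.single (2 : Fin 3) (1 : ℤ)) (EuclideanSpace.single (0 : Fin 3) ν) false)) x =
      (4 * Real.pi ^ 2 * ν) • stokesMode (Pi.single (2 : Fin 3) (1 : ℤ)) (EuclideanSpace.single (0 : Fin 3) ν) false x := by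
  rw [convect_sinMode_sinMode (single_apply_two ν), laplacian_axialMode, gradient_zero_scalar'', zero_smul,
    smul_smul]
  simp only [zero_sub, add_zero, sub_zero, mul_neg, neg_smul, neg_neg]
  congr 1
  ring

/-- **Data of the shear state** at viscosity `0 < ν`: smooth, divergence free, mean zero,
`|u₀| ≤ ν`, `|∂ᵢu₀| ≤ 2πν`, genuinely `x₃`-dependent (`‖∂₃u₀‖₂² = 2π²ν² > 0`), and its force
`f₀ = 4π²ν u₀` is smooth and mean zero. -/
theorem shear_data {ν : ℝ} (hν : 0 < ν) :
    IsSmooth (⇑(stokesMode (Pi.single (2 : Fin 3) (1 : ℤ)) (EuclideanSpace.single (0 : Fin 3) ν) false)) ∧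
    IsDivFree (⇑(stokesMode (Pi.single (2 : Fin 3) (1 : ℤ)) (EuclideanSpace.single (0 : Fin 3) ν) false)) ∧
    HasZeroMean (⇑(stokesMode (Pi.single (2 : Fin 3) (1 : ℤ)) (EuclideanSpace.single (0 : Fin 3) ν) false)) ∧
    (∀ x, ‖stokesMode (Pi.single (2 : Fin 3) (1 : ℤ)) (EuclideanSpace.single (0 : Fin 3) ν) false x‖ ≤ ν) ∧
    (∀ (i : Fin 3) x, ‖Torus.partialDeriv i
        (⇑(stokesMode (Pi.single (2 : Fin 3) (1 : ℤ)) (EuclideanSpace.single (0 : Fin 3) ν) false)) x‖ ≤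
      2 * Real.pi * ν) ∧
    MeasureTheory.integral MeasureTheory.volume (fun x => ‖Torus.partialDeriv (2 : Fin 3)
        (⇑(stokesMode (Pi.single (2 : Fin 3) (1 : ℤ)) (EuclideanSpace.single (0 : Fin 3) ν) false)) x‖ ^ 2) =
      2 * Real.pi ^ 2 * ν ^ 2 ∧
    IsSmooth (fun x => (4 * Real.pi ^ 2 * ν) •
        stokesMode (Pi.single (2 : Fin 3) (1 : ℤ)) (EuclideanSpace.single (0 : Fin 3) ν) false x) ∧
    HasZeroMean (fun x => (4 * Real.pi ^ 2 * ν) •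
        stokesMode (Pi.single (2 : Fin 3) (1 : ℤ)) (EuclideanSpace.single (0 : Fin 3) ν) false x) := by
  have ha := single_apply_two ν
  have hna := norm_single_eq hν
  have hS : IsSmooth (⇑(stokesMode (Pi.single (2 : Fin 3) (1 : ℤ)) (EuclideanSpace.single (0 : Fin 3) ν) false)) :=
    isSmooth_stokesMode _ _ _
  have hSm : HasZeroMean (⇑(stokesMode (Pi.single (2 : Fin 3) (1 : ℤ)) (EuclideanSpace.single (0 : Fin 3) ν) false)) :=
    hasZeroMean_stokesMode axial_ne_zero _ _
  refine ⟨hS, isDivFree_stokesMode (transversal_of_apply_two ha) _, hSm, ?_, ?_, ?_, hS.smul _, ?_⟩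
  · intro x
    exact (norm_stokesMode_le _ _ _ x).trans_eq hna
  · intro i x
    exact (norm_partialDeriv_sinMode_le i x).trans_eq (by rw [hna])
  · have h1 : (fun x => ‖Torus.partialDeriv (2 : Fin 3)
        (⇑(stokesMode (Pi.single (2 : Fin 3) (1 : ℤ)) (EuclideanSpace.single (0 : Fin 3) ν) false)) x‖ ^ 2) =
        fun x => (2 * Real.pi) ^ 2 *
          ‖stokesMode (Pi.single (2 : Fin 3) (1 : ℤ)) (EuclideanSpace.single (0 : Fin 3) ν) true x‖ ^ 2 := by
      funext x
      rw [partialDeriv_two_sinMode, norm_smul, mul_pow, Real.norm_eq_abs,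
        abs_of_pos (by positivity : (0:ℝ) < 2 * Real.pi)]
    rw [h1, integral_const_mul, gpForce_integral_norm_sq_stokesMode axial_ne_zero, hna]
    ring
  · unfold HasZeroMean
    rw [integral_smul, hSm, smul_zero]

end ExactState

section NonVacuity

/-- **THE HYPOTHESES OF THE TRANSFER `C⁺` ARE JOINTLY SATISFIABLE** (non-vacuity of stub
`stub_quantPersistenceCore`'s conclusion and of the crux's a-priori clause at fixed viscosity): for
every `0 < ν ≤ 1` the shear state `u₀ = ν sin(2πx₃) e₀`, pressure `p₀ = 0`, drift `c = 0`, force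
`f₀ = 4π²ν u₀`, constants `C = 2π`, `M = 5ν⁻¹` satisfy ALL the inner hypotheses of `C⁺` (exact
drifted steady state, sup bounds `|u₀| ≤ C`, `|∂u₀| ≤ Cν⁻¹`, bordered `L²` a-priori bound with
constant `M`) — and the state is genuinely three-dimensional (`‖∂₃u₀‖₂² > 0`). -/
theorem quantPersistence_hypotheses_inhabited {ν : ℝ} (hν : 0 < ν) (hν1 : ν ≤ 1) :
    ∃ (C M : ℝ) (f₀ u₀ : UnitAddTorus (Fin 3) → EuclideanSpace ℝ (Fin 3)) (p₀ : UnitAddTorus (Fin 3) → ℝ) (c : ℝ),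
      0 ≤ C ∧ 0 ≤ M ∧ IsSmooth f₀ ∧ HasZeroMean f₀ ∧ IsSmooth u₀ ∧ IsSmooth p₀ ∧ IsDivFree u₀ ∧
      HasZeroMean u₀ ∧ |c| ≤ C ∧ (∀ x, ‖u₀ x‖ ≤ C) ∧
      (∀ (i : Fin 3) x, ‖Torus.partialDeriv i u₀ x‖ ≤ C * ν⁻¹) ∧
      (∀ x, Torus.convect u₀ u₀ x - ν • Torus.laplacian u₀ x + Torus.gradient p₀ x -
          c • Torus.partialDeriv (2 : Fin 3) u₀ x = f₀ x) ∧
      (∀ (v : UnitAddTorus (Fin 3) → EuclideanSpace ℝ (Fin 3)) (r : UnitAddTorus (Fin 3) → ℝ) (b : ℝ),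
        IsSmooth v → IsSmooth r → IsDivFree v → HasZeroMean v →
        MeasureTheory.integral MeasureTheory.volume (fun x => ‖v x‖ ^ 2) + b ^ 2 ≤
          M ^ 2 * (MeasureTheory.integral MeasureTheory.volume (fun x =>
            ‖Torus.convect u₀ v x + Torus.convect v u₀ x - ν • Torus.laplacian v x + Torus.gradient r x -
              c • Torus.partialDeriv (2 : Fin 3) v x - b • Torus.partialDeriv (2 : Fin 3) u₀ x‖ ^ 2) +
            (MeasureTheory.integral MeasureTheory.volume (fun x =>
              inner ℝ (v x) (Torus.partialDeriv (2 : Fin 3) u₀ x))) ^ 2)) ∧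
      0 < MeasureTheory.integral MeasureTheory.volume (fun x => ‖Torus.partialDeriv (2 : Fin 3) u₀ x‖ ^ 2) := by
  obtain ⟨hS, hSd, hSm, hsup, hsup1, hJ, hf₀, hf₀m⟩ := shear_data hν
  refine ⟨2 * Real.pi, 5 * ν⁻¹, fun x => (4 * Real.pi ^ 2 * ν) •
      stokesMode (Pi.single (2 : Fin 3) (1 : ℤ)) (EuclideanSpace.single (0 : Fin 3) ν) false x,
    ⇑(stokesMode (Pi.single (2 : Fin 3) (1 : ℤ)) (EuclideanSpace.single (0 : Fin 3) ν) false),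
    fun _ => 0, 0, by positivity, by positivity, hf₀, hf₀m, hS, isSmooth_const _, hSd, hSm,
    by simp; positivity, ?_, ?_, shear_exact ν, borderedBound_shear hν, ?_⟩
  · intro x
    have hπ := Real.pi_gt_three
    exact (hsup x).trans (by linarith)
  · intro i x
    have hπ := Real.pi_gt_three
    have h1 : 2 * Real.pi * ν ≤ 2 * Real.pi * ν⁻¹ := by
      have h2 : (1 : ℝ) ≤ ν⁻¹ := one_le_inv_iff₀.mpr ⟨hν, hν1⟩
      have : ν ≤ ν⁻¹ := hν1.trans h2
      nlinarith
    exact (hsup1 i x).trans h1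
  · rw [hJ]; positivity

end NonVacuity


section MeanZeroForce

/-- **The full steady left-hand side is mean zero** (calculus fact (i) of the line, the solvability
obstruction): `∫ (u·∇u − νΔu + ∇p − c∂₃u) = 0` for smooth divergence-free `u` and smooth `p`. -/
theorem integral_steadyLHS_eq_zero {u : UnitAddTorus (Fin 3) → EuclideanSpace ℝ (Fin 3)}
    {p : UnitAddTorus (Fin 3) → ℝ} (hu : IsSmooth u) (hp : IsSmooth p) (hud : IsDivFree u) (ν c : ℝ) :
    ∫ x, (Torus.convect u u x - ν • Torus.laplacian u x + Torus.gradient p x -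
      c • Torus.partialDeriv (2 : Fin 3) u x) = 0 := by
  have i1 : Integrable (fun x => Torus.convect u u x) volume := (hu.convect hu).integrable
  have i2 : Integrable (fun x => ν • Torus.laplacian u x) volume := (hu.laplacian.smul ν).integrable
  have i3 : Integrable (fun x => Torus.gradient p x) volume := hp.gradient.integrable
  have i4 : Integrable (fun x => c • Torus.partialDeriv (2 : Fin 3) u x) volume :=
    ((hu.partialDeriv 2).smul c).integrable
  have j2 : Integrable (fun x => Torus.convect u u x - ν • Torus.laplacian u x) volume := i1.sub i2
  have j3 : Integrable (fun x => Torus.convect u u x - ν • Torus.laplacian u x + Torus.gradient p x) volume :=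
    j2.add i3
  rw [integral_sub j3 i4, integral_add j2 i3, integral_sub i1 i2, integral_smul, integral_smul]
  have z1 : ∫ x, Torus.convect u u x = 0 := integral_fderiv_apply_eq_zero_of_isDivFree hu hu hud
  have z2 : ∫ x, Torus.laplacian u x = 0 := by
    simp_rw [laplacian_eq_sum_partialDeriv_partialDeriv hu]
    rw [integral_finsetSum _ (fun i _ => ((hu.partialDeriv i).partialDeriv i).integrable)]
    exact Finset.sum_eq_zero fun i _ => integral_partialDeriv_eq_zero_holds (hu.partialDeriv i) i
  have z3 : ∫ x, Torus.gradient p x = 0 := by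
    simp_rw [gradient_eq_sum_partialDeriv (hp.isContDiff (by simp))]
    rw [integral_finsetSum _ (fun i _ => ((hp.partialDeriv i).integrable).smul_const _)]
    exact Finset.sum_eq_zero fun i _ => by
      rw [integral_smul_const, integral_partialDeriv_eq_zero_holds hp i, zero_smul]
  have z4 : ∫ x, Torus.partialDeriv (2 : Fin 3) u x = 0 := integral_partialDeriv_eq_zero_holds hu 2
  rw [z1, z2, z3, z4]
  simp

/-- Divergence is homogeneous under constant scalars (no differentiability needed). [folklore] -/
theorem isDivFree_const_smul {u : UnitAddTorus (Fin 3) → EuclideanSpace ℝ (Fin 3)}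
    (hu : IsDivFree u) (c : ℝ) : IsDivFree (fun x => c • u x) := by
  intro x
  have h := hu x
  simp only [Torus.divergence, Torus.partialDeriv, Torus.lineDeriv] at h ⊢
  have e : ∀ i : Fin 3, deriv (fun t : ℝ => (c • u (x + Torus.proj (t • EuclideanSpace.single i (1:ℝ)))) i) 0 =
      c * deriv (fun t : ℝ => u (x + Torus.proj (t • EuclideanSpace.single i (1:ℝ))) i) 0 := by
    intro i
    simp only [PiLp.smul_apply, smul_eq_mul]
    exact deriv_const_mul_field c
  simp_rw [e, ← Finset.mul_sum, h, mul_zero]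

/-- Adding a constant vector does not change the divergence. [folklore] -/
theorem isDivFree_add_const {u : UnitAddTorus (Fin 3) → EuclideanSpace ℝ (Fin 3)}
    (hu : IsDivFree u) (e : EuclideanSpace ℝ (Fin 3)) : IsDivFree (fun x => u x + e) := by
  intro x
  have h := hu x
  simp only [Torus.divergence, Torus.partialDeriv, Torus.lineDeriv] at h ⊢
  have e' : ∀ i : Fin 3, deriv (fun t : ℝ => (u (x + Torus.proj (t • EuclideanSpace.single i (1:ℝ))) + e) i) 0 =
      deriv (fun t : ℝ => u (x + Torus.proj (t • EuclideanSpace.single i (1:ℝ))) i) 0 := by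
    intro i
    simp only [PiLp.add_apply]
    exact deriv_add_const _
  simp_rw [e', h]

/-- **`C⁺` (`stub_quantPersistenceCore`'s conclusion) `_false_without_` `HasZeroMean f`.** Delete the
mean-zero hypothesis on the target force and the transfer is FALSE: at the shear state (viscosity
`1`, `C = 2π`, `M = 5`, all other hypotheses in force — `quantPersistence_hypotheses_inhabited`),
the smooth divergence-free force `f = f₀ + P⁻² e₀` lies in the Kantorovich ball `‖f − f₀‖₂² = P⁻⁴`
but has mean `P⁻² e₀ ≠ 0`, while every exact steady left-hand side `u·∇u − νΔu + ∇p − c'∂₃u` has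
mean zero (`integral_steadyLHS_eq_zero`): no realisation exists.  So the mean-zero hypothesis on `f`
(equivalently the conserved-mean leaf of `SteadyLatticeDrift`) is load-bearing in stub C. -/
theorem quantPersistence_false_without_meanZero_f :
    ¬ (∃ (k : ℕ) (A : ℝ), 0 < A ∧ ∀ (ν C M : ℝ) (f₀ f u₀ : UnitAddTorus (Fin 3) → EuclideanSpace ℝ (Fin 3))
        (p₀ : UnitAddTorus (Fin 3) → ℝ) (c : ℝ),
      0 < ν → ν ≤ 1 → 0 ≤ C → 0 ≤ M →
      IsSmooth f₀ → HasZeroMean f₀ → IsSmooth f → IsDivFree f →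
      IsSmooth u₀ → IsSmooth p₀ → IsDivFree u₀ → HasZeroMean u₀ → |c| ≤ C → (∀ x, ‖u₀ x‖ ≤ C) →
      (∀ (i : Fin 3) x, ‖Torus.partialDeriv i u₀ x‖ ≤ C * ν⁻¹) →
      (∀ x, Torus.convect u₀ u₀ x - ν • Torus.laplacian u₀ x + Torus.gradient p₀ x -
          c • Torus.partialDeriv (2 : Fin 3) u₀ x = f₀ x) →
      (∀ (v : UnitAddTorus (Fin 3) → EuclideanSpace ℝ (Fin 3)) (r : UnitAddTorus (Fin 3) → ℝ) (b : ℝ),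
        IsSmooth v → IsSmooth r → IsDivFree v → HasZeroMean v →
        MeasureTheory.integral MeasureTheory.volume (fun x => ‖v x‖ ^ 2) + b ^ 2 ≤
          M ^ 2 * (MeasureTheory.integral MeasureTheory.volume (fun x =>
            ‖Torus.convect u₀ v x + Torus.convect v u₀ x - ν • Torus.laplacian v x + Torus.gradient r x -
              c • Torus.partialDeriv (2 : Fin 3) v x - b • Torus.partialDeriv (2 : Fin 3) u₀ x‖ ^ 2) +
            (MeasureTheory.integral MeasureTheory.volume (fun x =>
              inner ℝ (v x) (Torus.partialDeriv (2 : Fin 3) u₀ x))) ^ 2)) →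
      MeasureTheory.integral MeasureTheory.volume (fun x => ‖f x - f₀ x‖ ^ 2) ≤
        ((A * (1 + M) ^ k * (1 + C) ^ k * ν⁻¹ ^ k) ^ 4)⁻¹ →
      ∃ (u : UnitAddTorus (Fin 3) → EuclideanSpace ℝ (Fin 3)) (p : UnitAddTorus (Fin 3) → ℝ) (c' : ℝ),
        IsSmooth u ∧ IsSmooth p ∧ IsDivFree u ∧ HasZeroMean u ∧
        (∀ x, Torus.convect u u x - ν • Torus.laplacian u x + Torus.gradient p x -
            c' • Torus.partialDeriv (2 : Fin 3) u x = f x) ∧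
        MeasureTheory.integral MeasureTheory.volume (fun x => ‖u x - u₀ x‖ ^ 2) +
            gradNormSq (fun x => u x - u₀ x) + (c' - c) ^ 2 ≤
          (A * (1 + M) ^ k * (1 + C) ^ k * ν⁻¹ ^ k) ^ 2 *
            MeasureTheory.integral MeasureTheory.volume (fun x => ‖f x - f₀ x‖ ^ 2)) := by
  rintro ⟨k, A, hA, h⟩
  obtain ⟨hS, hSd, hSm, hsup, hsup1, -, hf₀, hf₀m⟩ := shear_data one_pos
  -- the Kantorovich radius at the shear state (ν = 1, C = 2π, M = 5)
  set P : ℝ := A * (1 + 5 * (1:ℝ)⁻¹) ^ k * (1 + 2 * Real.pi) ^ k * (1:ℝ)⁻¹ ^ k with hP_def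
  have hP : 0 < P := by positivity
  set δ : ℝ := (P ^ 2)⁻¹ with hδ
  have hδ0 : 0 < δ := by positivity
  -- the non-mean-zero target force `f = f₀ + δ e₀`
  have hfs : IsSmooth (fun x => (4 * Real.pi ^ 2 * (1:ℝ)) •
      stokesMode (Pi.single (2 : Fin 3) (1 : ℤ)) (EuclideanSpace.single (0 : Fin 3) (1:ℝ)) false x +
      δ • EuclideanSpace.single (0 : Fin 3) (1 : ℝ)) := hf₀.add (isSmooth_const _)
  have hfd : IsDivFree (fun x => (4 * Real.pi ^ 2 * (1:ℝ)) •
      stokesMode (Pi.single (2 : Fin 3) (1 : ℤ)) (EuclideanSpace.single (0 : Fin 3) (1:ℝ)) false x +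
      δ • EuclideanSpace.single (0 : Fin 3) (1 : ℝ)) :=
    isDivFree_add_const (isDivFree_const_smul hSd _) _
  have hsmall : MeasureTheory.integral MeasureTheory.volume (fun x =>
      ‖((4 * Real.pi ^ 2 * (1:ℝ)) •
          stokesMode (Pi.single (2 : Fin 3) (1 : ℤ)) (EuclideanSpace.single (0 : Fin 3) (1:ℝ)) false x +
          δ • EuclideanSpace.single (0 : Fin 3) (1 : ℝ)) -
        (4 * Real.pi ^ 2 * (1:ℝ)) •
          stokesMode (Pi.single (2 : Fin 3) (1 : ℤ)) (EuclideanSpace.single (0 : Fin 3) (1:ℝ)) false x‖ ^ 2) ≤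
      ((A * (1 + 5 * (1:ℝ)⁻¹) ^ k * (1 + 2 * Real.pi) ^ k * (1:ℝ)⁻¹ ^ k) ^ 4)⁻¹ := by
    have e : (fun x => ‖((4 * Real.pi ^ 2 * (1:ℝ)) •
          stokesMode (Pi.single (2 : Fin 3) (1 : ℤ)) (EuclideanSpace.single (0 : Fin 3) (1:ℝ)) false x +
          δ • EuclideanSpace.single (0 : Fin 3) (1 : ℝ)) -
        (4 * Real.pi ^ 2 * (1:ℝ)) •
          stokesMode (Pi.single (2 : Fin 3) (1 : ℤ)) (EuclideanSpace.single (0 : Fin 3) (1:ℝ)) false x‖ ^ 2) =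
        fun _ => δ ^ 2 := by
      funext x
      rw [add_sub_cancel_left, norm_smul, Real.norm_eq_abs, abs_of_pos hδ0]
      simp
    rw [e, integral_const]
    have hvol : (volume : Measure (UnitAddTorus (Fin 3))).real Set.univ = 1 := by simp
    rw [hvol, one_smul, ← hP_def, hδ, inv_pow, ← pow_mul]
  obtain ⟨u, p, c', hu, hp, hud, -, heq, -⟩ := h 1 (2 * Real.pi) (5 * (1:ℝ)⁻¹) _ _ _ (fun _ => 0) 0
    one_pos le_rfl (by positivity) (by positivity) hf₀ hf₀m hfs hfd hS (isSmooth_const _) hSd hSm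
    (by simp; positivity) (fun x => (hsup x).trans (by linarith [Real.pi_gt_three]))
    (fun i x => (hsup1 i x).trans (by simp)) (shear_exact 1) (borderedBound_shear one_pos) hsmall
  -- integrate the realised equation: the left-hand side has mean zero, the force has mean `δ e₀`
  have hint := integral_steadyLHS_eq_zero hu hp hud 1 c'
  have hfeq : (fun x => Torus.convect u u x - (1:ℝ) • Torus.laplacian u x + Torus.gradient p x -
      c' • Torus.partialDeriv (2 : Fin 3) u x) = fun x => (4 * Real.pi ^ 2 * (1:ℝ)) •
      stokesMode (Pi.single (2 : Fin 3) (1 : ℤ)) (EuclideanSpace.single (0 : Fin 3) (1:ℝ)) false x +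
      δ • EuclideanSpace.single (0 : Fin 3) (1 : ℝ) := funext heq
  rw [hfeq, integral_add hf₀.integrable (integrable_const _), integral_const] at hint
  have h0 : ∫ x, (4 * Real.pi ^ 2 * (1:ℝ)) •
      stokesMode (Pi.single (2 : Fin 3) (1 : ℤ)) (EuclideanSpace.single (0 : Fin 3) (1:ℝ)) false x = 0 := hf₀m
  rw [h0, zero_add] at hint
  have hvol : (volume : Measure (UnitAddTorus (Fin 3))).real Set.univ = 1 := by simp
  rw [hvol, one_smul] at hint
  have := congrArg (fun w : EuclideanSpace ℝ (Fin 3) => w 0) hint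
  simp at this
  exact absurd this hδ0.ne'

end MeanZeroForce


end Summit.AnomalousDissipation.AnomalousDissipation.Theorems.NewtonRealisation.Negative

end
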